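import Summits.AtomisticToContinuum.HydrodynamicLimit.Theorems.CollisionIsometryCLTAdaptedWeightCLTSustainedAnisotropyB
import Summits.AtomisticToContinuum.HydrodynamicLimit.Theorems.CollisionIsometryCLTAdaptedWeightCLTCBTimeZero

/-!
# Line `sustained-anisotropy-superexp`, stub `stub_cellUI`, file 1: the COVERING BOUND for the cell velocities

Crux `CollisionIsometryCLT.AdaptedWeightCLT` (stmt-AtomisticToContinuum-14868, rev-12 TIME-LOCAL form), route
`CollisionIsometryCLT`, sub-problem `HydrodynamicLimit`; `--supports` helper toward the registered stub `stub_cellUI`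
(the uniform-integrability input `CellUIBound` of the reshaped window stub).

The cell velocity of particle `i` is the row-normalised average `cvel_i = S_i⁻¹ Σ_k w_{ik} v_k`,
`w_{ik} = ψ_N(x_k − x_i)`, `S_i = Σ_k w_{ik}`, of the particle velocities. This file proves the one
combinatorial fact the UI bound needs about it: for every power `p`,

  `Σ_i ‖cvel_i‖^p ≤ Kcol · Σ_j ‖v_j‖^p`,   `Kcol = 729 · Cψ / cψ`   (`sum_norm_cvel_pow_le`),

for every configuration (no hard core needed) as soon as the cell radius `ℓ_N ≤ 1/4`.

* JENSEN row by row (`TimeZero.sum_mul_norm_avg_pow_le`): `S_i ‖cvel_i‖^p ≤ Σ_k w_{ik} ‖v_k‖^p`, and `S_i ≥ w_{ii} =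
  ψ_N(0) ≥ cψ ℓ⁻³ > 0` (core clause of `CellKernel`), so after exchanging the sums everything rests on
* THE COLUMN-SUM BOUND `Σ_i w_{ij}/S_i ≤ 729 Cψ/cψ` (`colsum_le`): the `i` with `w_{ij} ≠ 0` lie within `ℓ` of `x_j`
  (support clause); among them choose an `ℓ/4`-separated `ℓ/4`-net `Y` (a separated subset of maximal cardinality,
  `exists_separated_net`); `|Y| ≤ 9³` by the torus packing lemma `PastDamping.card_filter_near_le`; and if `x_i` is
  within `ℓ/4` of the net point `x_y`, every particle within `ℓ/4` of `x_y` is within `ℓ/2` of `x_i`, where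
  `w_{i·} ≥ cψ ℓ⁻³` (core clause), so `S_i ≥ cψ ℓ⁻³ · c_y` with `c_y` the number of particles within `ℓ/4` of `x_y`;
  hence `w_{ij}/S_i ≤ (Cψ/cψ) Σ_{y ∈ Y} 𝟙[d(x_i, x_y) < ℓ/4]/c_y`, and summing over `i` first gives `(Cψ/cψ)|Y|`.
-/

namespace Summit.AtomisticToContinuum.HydrodynamicLimit.Theorems.SustainedAnisotropy

open scoped BigOperators Topology Classical MeasureTheory ENNReal InnerProductSpace
open Filter Set MeasureTheory
open Literature.Analysis.FluidPDE Literature.Analysis.FluidPDE.Torus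
open Summit.AtomisticToContinuum.HydrodynamicLimit.Theorems.ContactSourceDuhamel
open Summit.AtomisticToContinuum.HydrodynamicLimit.Theorems.ContactSourceDuhamel.TimeLocal
open Summit.AtomisticToContinuum.HydrodynamicLimit.Theorems.ContactBalance
open Literature.MathematicalPhysics.KineticTheory (hsDiameter localGibbsLaw empiricalDensityField
  empiricalMomentumField)

noncomputable section

namespace CellUI

/-! ## Separated nets and packing on `𝕋³` -/

/-- In a family of points of `𝕋³`, every finite index set `T` contains an `ε`-SEPARATED subset `Y` (pairwise
minimal-image distances `≥ ε`) which is an `ε`-NET of `T` (every point of `T` is within `< ε` of a point of `Y`):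
any separated subset of maximal cardinality. -/
theorem exists_separated_net {ι : Type*} (T : Finset ι) (x : ι → T3) {ε : ℝ} (hε : 0 < ε) :
    ∃ Y : Finset ι, Y ⊆ T ∧ (∀ a ∈ Y, ∀ b ∈ Y, a ≠ b → ε ≤ euclidDist (x a) (x b)) ∧
      ∀ i ∈ T, ∃ y ∈ Y, euclidDist (x i) (x y) < ε := by
  set S : Finset (Finset ι) :=
    T.powerset.filter fun Y => ∀ a ∈ Y, ∀ b ∈ Y, a ≠ b → ε ≤ euclidDist (x a) (x b) with hS
  have hne : S.Nonempty :=
    ⟨∅, Finset.mem_filter.2 ⟨Finset.mem_powerset.2 (Finset.empty_subset T), fun a ha => absurd ha (by simp)⟩⟩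
  obtain ⟨Y, hY, hmax⟩ := S.exists_max_image Finset.card hne
  obtain ⟨hYT, hsep⟩ := Finset.mem_filter.1 hY
  rw [Finset.mem_powerset] at hYT
  refine ⟨Y, hYT, hsep, fun i hi => ?_⟩
  by_contra h
  simp only [not_exists, not_and, not_lt] at h
  have hiY : i ∉ Y := fun hiY => by
    have h0 := h i hiY
    rw [euclidDist_self] at h0
    exact absurd h0 (not_le.2 hε)
  have hins : insert i Y ∈ S := by
    refine Finset.mem_filter.2 ⟨Finset.mem_powerset.2 (Finset.insert_subset hi hYT), ?_⟩
    intro a ha b hb hab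
    rcases Finset.mem_insert.1 ha with rfl | ha'
    · rcases Finset.mem_insert.1 hb with rfl | hb'
      · exact absurd rfl hab
      · exact h b hb'
    · rcases Finset.mem_insert.1 hb with rfl | hb'
      · rw [euclidDist_comm]; exact h a ha'
      · exact hsep a ha' b hb' hab
  have hle := hmax _ hins
  rw [Finset.card_insert_of_notMem hiY] at hle
  omega

/-- PACKING: an `ℓ/4`-separated family of points within minimal-image distance `< ℓ` of a point of `𝕋³` has at
most `729 = 9³` members (`ℓ ≤ 1/4`; `PastDamping.card_filter_near_le`). -/
theorem card_separated_le {ι : Type*} (Y : Finset ι) (x : ι → T3) (x₀ : T3) {ℓ : ℝ} (hℓ : 0 < ℓ)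
    (hℓ' : ℓ ≤ 1 / 4) (hsep : ∀ a ∈ Y, ∀ b ∈ Y, a ≠ b → ℓ / 4 ≤ euclidDist (x a) (x b))
    (hnear : ∀ a ∈ Y, euclidDist (x a) x₀ < ℓ) : (Y.card : ℝ) ≤ 729 := by
  have h := PastDamping.card_filter_near_le Y x x₀ (ε := ℓ / 4) (R := ℓ) (by positivity) hℓ.le
    (by linarith) hsep
  rw [Finset.filter_true_of_mem hnear] at h
  have h8 : 2 * ℓ / (ℓ / 4) = 8 := by
    rw [div_div_eq_mul_div, div_eq_iff hℓ.ne']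
    ring
  rw [h8] at h
  norm_num at h
  exact_mod_cast h

/-! ## The column-sum bound -/

/-- THE COLUMN-SUM BOUND. Points `x_i ∈ 𝕋³`; a kernel `K ≥ 0` supported in the minimal-image ball of radius
`ℓ ≤ 1/4` about `0`, of height `≤ Cψ ℓ⁻³`, and `≥ cψ ℓ⁻³ > 0` on the ball of radius `ℓ/2`; weights
`w_{ik} = K(x_k − x_i)` with row sums `S_i = Σ_k w_{ik}`. Then every COLUMN of the row-normalised matrix has sum
`Σ_i w_{ij}/S_i ≤ 729 Cψ/cψ`. -/
theorem colsum_le {ι : Type*} [Fintype ι] (x : ι → T3) (K : T3 → ℝ) {ℓ Cψ cψ : ℝ} (hℓ : 0 < ℓ)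
    (hℓ' : ℓ ≤ 1 / 4) (hK0 : ∀ y, 0 ≤ K y) (hsupp : ∀ y, ℓ ≤ euclidDist y 0 → K y = 0)
    (hKC : ∀ y, K y ≤ Cψ * ℓ⁻¹ ^ 3) (hc : 0 < cψ)
    (hKc : ∀ y, euclidDist y 0 ≤ ℓ / 2 → cψ * ℓ⁻¹ ^ 3 ≤ K y) (j : ι) :
    ∑ i, K (x j - x i) / ∑ k, K (x k - x i) ≤ 729 * Cψ / cψ := by
  -- the net of the column's support
  set T : Finset ι := Finset.univ.filter fun i => euclidDist (x i) (x j) < ℓ with hT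
  obtain ⟨Y, hYT, hsep, hnet⟩ := exists_separated_net T x (ε := ℓ / 4) (by positivity)
  have hYnear : ∀ a ∈ Y, euclidDist (x a) (x j) < ℓ := fun a ha => (Finset.mem_filter.1 (hYT ha)).2
  have hcard : (Y.card : ℝ) ≤ 729 := card_separated_le Y x (x j) hℓ hℓ' hsep hYnear
  -- particle counts near the net points
  set c : ι → ℕ := fun y => (Finset.univ.filter fun k => euclidDist (x k) (x y) < ℓ / 4).card with hcdef
  have hcpos : ∀ y, 0 < (c y : ℝ) := fun y => by
    have hy : y ∈ Finset.univ.filter fun k => euclidDist (x k) (x y) < ℓ / 4 :=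
      Finset.mem_filter.2 ⟨Finset.mem_univ _, by rw [euclidDist_self]; positivity⟩
    exact_mod_cast Finset.card_pos.2 ⟨y, hy⟩
  have hℓ3 : 0 < ℓ⁻¹ ^ 3 := by positivity
  have hCc : cψ ≤ Cψ := by
    have h := (hKc 0 (by rw [euclidDist_self]; positivity)).trans (hKC 0)
    exact le_of_mul_le_mul_right h hℓ3
  have hC0 : 0 ≤ Cψ := hc.le.trans hCc
  have hCc0 : 0 ≤ Cψ / cψ := div_nonneg hC0 hc.le
  have hind0 : ∀ i y, (0 : ℝ) ≤ if euclidDist (x i) (x y) < ℓ / 4 then (c y : ℝ)⁻¹ else 0 :=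
    fun i y => by
      split_ifs
      · exact inv_nonneg.2 (hcpos y).le
      · exact le_rfl
  -- pointwise: `w_ij/S_i ≤ (Cψ/cψ) Σ_{y ∈ Y} 1[d(x_i, x_y) < ℓ/4]/c_y`
  have hpt : ∀ i, K (x j - x i) / ∑ k, K (x k - x i) ≤
      Cψ / cψ * ∑ y ∈ Y, if euclidDist (x i) (x y) < ℓ / 4 then (c y : ℝ)⁻¹ else 0 := by
    intro i
    have hrhs : 0 ≤ ∑ y ∈ Y, if euclidDist (x i) (x y) < ℓ / 4 then (c y : ℝ)⁻¹ else 0 :=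
      Finset.sum_nonneg fun y _ => hind0 i y
    by_cases hw : K (x j - x i) = 0
    · rw [hw, zero_div]; exact mul_nonneg hCc0 hrhs
    · -- `i ∈ T`: pick a net point `y₀`
      have hiT : i ∈ T := by
        refine Finset.mem_filter.2 ⟨Finset.mem_univ _, ?_⟩
        by_contra hge
        exact hw (hsupp _ (by
          rw [PastDamping.euclidDist_sub_zero, euclidDist_comm]; exact not_lt.1 hge))
      obtain ⟨y₀, hy₀, hiy₀⟩ := hnet i hiT
      -- `S_i ≥ cψ ℓ⁻³ c_{y₀}`: everything within `ℓ/4` of `x_{y₀}` is within `ℓ/2` of `x_i`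
      have hS : cψ * ℓ⁻¹ ^ 3 * c y₀ ≤ ∑ k, K (x k - x i) := by
        calc cψ * ℓ⁻¹ ^ 3 * c y₀
            = ∑ _k ∈ Finset.univ.filter (fun k => euclidDist (x k) (x y₀) < ℓ / 4), cψ * ℓ⁻¹ ^ 3 := by
              rw [Finset.sum_const, nsmul_eq_mul, mul_comm]
          _ ≤ ∑ k ∈ Finset.univ.filter (fun k => euclidDist (x k) (x y₀) < ℓ / 4), K (x k - x i) := by
              refine Finset.sum_le_sum fun k hk => hKc _ ?_
              have hk' : euclidDist (x k) (x y₀) < ℓ / 4 := (Finset.mem_filter.1 hk).2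
              have htri := euclidDist_triangle (x k) (x y₀) (x i)
              rw [euclidDist_comm (x y₀) (x i)] at htri
              rw [PastDamping.euclidDist_sub_zero]
              linarith
          _ ≤ ∑ k, K (x k - x i) :=
              Finset.sum_le_sum_of_subset_of_nonneg (Finset.filter_subset _ _) fun k _ _ => hK0 _
      have hden : 0 < cψ * ℓ⁻¹ ^ 3 * c y₀ := mul_pos (mul_pos hc hℓ3) (hcpos y₀)
      calc K (x j - x i) / ∑ k, K (x k - x i) ≤ Cψ * ℓ⁻¹ ^ 3 / (cψ * ℓ⁻¹ ^ 3 * c y₀) :=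
            div_le_div₀ (mul_nonneg hC0 hℓ3.le) (hKC _) hden hS
        _ = Cψ / cψ * (c y₀ : ℝ)⁻¹ := by
            field_simp
        _ ≤ Cψ / cψ * ∑ y ∈ Y, if euclidDist (x i) (x y) < ℓ / 4 then (c y : ℝ)⁻¹ else 0 := by
            refine mul_le_mul_of_nonneg_left ?_ hCc0
            have h1 := Finset.single_le_sum
              (f := fun y => if euclidDist (x i) (x y) < ℓ / 4 then (c y : ℝ)⁻¹ else 0)
              (fun y _ => hind0 i y) hy₀
            simpa only [if_pos hiy₀] using h1
  -- sum over `i` and exchange the sums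
  calc ∑ i, K (x j - x i) / ∑ k, K (x k - x i)
      ≤ ∑ i, Cψ / cψ * ∑ y ∈ Y, if euclidDist (x i) (x y) < ℓ / 4 then (c y : ℝ)⁻¹ else 0 :=
        Finset.sum_le_sum fun i _ => hpt i
    _ = Cψ / cψ * ∑ y ∈ Y, ∑ i, if euclidDist (x i) (x y) < ℓ / 4 then (c y : ℝ)⁻¹ else 0 := by
        rw [← Finset.mul_sum, Finset.sum_comm]
    _ = Cψ / cψ * Y.card := by
        congr 1
        rw [Finset.card_eq_sum_ones Y, Nat.cast_sum, Nat.cast_one]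
        refine Finset.sum_congr rfl fun y _ => ?_
        rw [← Finset.sum_filter, Finset.sum_const, nsmul_eq_mul]
        exact mul_inv_cancel₀ (hcpos y).ne'
    _ ≤ Cψ / cψ * 729 := mul_le_mul_of_nonneg_left hcard hCc0
    _ = 729 * Cψ / cψ := by ring

/-! ## The covering bound -/

/-- THE COVERING BOUND for row-normalised averages: with `w_{ik} = K(x_k − x_i)` and `S_i = Σ_k w_{ik}` as in
`colsum_le`, `Σ_i ‖S_i⁻¹ Σ_k w_{ik} v_k‖^p ≤ (729 Cψ/cψ) Σ_k ‖v_k‖^p` for every `p` (Jensen row by row — every row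
sum is `≥ w_{ii} ≥ cψ ℓ⁻³ > 0` — then exchange the sums and use the column-sum bound). -/
theorem sum_norm_avg_pow_le {ι : Type*} [Fintype ι] (x : ι → T3) (v : ι → V3) (K : T3 → ℝ)
    {ℓ Cψ cψ : ℝ} (hℓ : 0 < ℓ) (hℓ' : ℓ ≤ 1 / 4) (hK0 : ∀ y, 0 ≤ K y)
    (hsupp : ∀ y, ℓ ≤ euclidDist y 0 → K y = 0) (hKC : ∀ y, K y ≤ Cψ * ℓ⁻¹ ^ 3) (hc : 0 < cψ)
    (hKc : ∀ y, euclidDist y 0 ≤ ℓ / 2 → cψ * ℓ⁻¹ ^ 3 ≤ K y) (p : ℕ) :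
    ∑ i, ‖(∑ k, K (x k - x i))⁻¹ • ∑ k, K (x k - x i) • v k‖ ^ p ≤
      729 * Cψ / cψ * ∑ k, ‖v k‖ ^ p := by
  have hrow : ∀ i, ‖(∑ k, K (x k - x i))⁻¹ • ∑ k, K (x k - x i) • v k‖ ^ p ≤
      ∑ k, K (x k - x i) / (∑ k', K (x k' - x i)) * ‖v k‖ ^ p := by
    intro i
    have hJ := TimeZero.sum_mul_norm_avg_pow_le Finset.univ v (fun k _ => hK0 (x k - x i)) p
    have hii : cψ * ℓ⁻¹ ^ 3 ≤ K (x i - x i) :=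
      hKc _ (by rw [sub_self, euclidDist_self]; positivity)
    have hiS : K (x i - x i) ≤ ∑ k, K (x k - x i) :=
      Finset.single_le_sum (f := fun k => K (x k - x i)) (fun k _ => hK0 _) (Finset.mem_univ i)
    have hc3 : 0 < cψ * ℓ⁻¹ ^ 3 := by positivity
    have hSpos : 0 < ∑ k, K (x k - x i) := by linarith
    refine ((le_div_iff₀' hSpos).2 hJ).trans (le_of_eq ?_)
    rw [Finset.sum_div]
    exact Finset.sum_congr rfl fun k _ => by ring
  calc ∑ i, ‖(∑ k, K (x k - x i))⁻¹ • ∑ k, K (x k - x i) • v k‖ ^ p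
      ≤ ∑ i, ∑ k, K (x k - x i) / (∑ k', K (x k' - x i)) * ‖v k‖ ^ p :=
        Finset.sum_le_sum fun i _ => hrow i
    _ = ∑ k, (∑ i, K (x k - x i) / ∑ k', K (x k' - x i)) * ‖v k‖ ^ p := by
        rw [Finset.sum_comm]
        exact Finset.sum_congr rfl fun k _ => (Finset.sum_mul _ _ _).symm
    _ ≤ ∑ k, 729 * Cψ / cψ * ‖v k‖ ^ p :=
        Finset.sum_le_sum fun k _ => mul_le_mul_of_nonneg_right
          (colsum_le x K hℓ hℓ' hK0 hsupp hKC hc hKc k) (pow_nonneg (norm_nonneg _) _)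
    _ = 729 * Cψ / cψ * ∑ k, ‖v k‖ ^ p := (Finset.mul_sum _ _ _).symm

/-- THE COVERING BOUND FOR THE CELL VELOCITIES of a cell kernel family: there is `Kcol ≥ 0` such that
`Σ_i ‖cvel_i‖^p ≤ Kcol · Σ_j ‖v_j‖^p` for every power `p`, every `N` with `ℓ_N ≤ 1/4` and every configuration
(`cvel_i = ū_ψ(x_i)` is the row-normalised average of the velocities with weights `ψ_N(x_k − x_i)`, `ubarC_eq`). -/
theorem sum_norm_cvel_pow_le {ψ : ℕ → T3 → ℝ} {ℓ : ℕ → ℝ} (hcell : CellKernel ψ ℓ) :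
    ∃ Kcol : ℝ, 0 ≤ Kcol ∧ ∀ N : ℕ, ℓ N ≤ 1 / 4 → ∀ (z : Cfg N) (p : ℕ),
      ∑ i, ‖cvel N ψ z i‖ ^ p ≤ Kcol * ∑ j, ‖(z j).2‖ ^ p := by
  obtain ⟨-, h0, -, hℓ, hsupp, ⟨Cψ, hC⟩, ⟨cψ, hc, hcψ⟩, -, -⟩ := hcell
  have hC0 : 0 ≤ Cψ := by
    have hℓ3 : 0 < (ℓ 0)⁻¹ ^ 3 := by have := hℓ 0; positivity
    have h := (hcψ 0 0 (by rw [euclidDist_self]; exact (half_pos (hℓ 0)).le)).trans (hC 0 0)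
    exact hc.le.trans (le_of_mul_le_mul_right h hℓ3)
  refine ⟨729 * Cψ / cψ, by positivity, fun N hN z p => ?_⟩
  have h := sum_norm_avg_pow_le (fun i => (z i).1) (fun i => (z i).2) (ψ N) (hℓ N) hN (h0 N) (hsupp N)
    (hC N) hc (hcψ N) p
  calc ∑ i, ‖cvel N ψ z i‖ ^ p
      = ∑ i, ‖(∑ k, ψ N ((z k).1 - (z i).1))⁻¹ • ∑ k, ψ N ((z k).1 - (z i).1) • (z k).2‖ ^ p := by
        refine Finset.sum_congr rfl fun i _ => ?_
        unfold cvel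
        rw [Pointwise.ubarC_eq]
        rfl
    _ ≤ 729 * Cψ / cψ * ∑ j, ‖(z j).2‖ ^ p := h

end CellUI

/-- Registered anchor of this helper file (`CellUI.sum_norm_cvel_pow_le`): the covering bound for the cell
velocities of a cell kernel family. -/
theorem cellUI_covering_anchor : ∀ (ψ : ℕ → T3 → ℝ) (ℓ : ℕ → ℝ), CellKernel ψ ℓ → ∃ Kcol : ℝ, 0 ≤ Kcol ∧ ∀ N : ℕ, ℓ N ≤ 1 / 4 → ∀ (z : Cfg N) (p : ℕ), ∑ i, ‖cvel N ψ z i‖ ^ p ≤ Kcol * ∑ j, ‖(z j).2‖ ^ p :=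
  fun _ _ hcell => CellUI.sum_norm_cvel_pow_le hcell

end

end Summit.AtomisticToContinuum.HydrodynamicLimit.Theorems.SustainedAnisotropy
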